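import Summits.QuantumFields.YangMills.Theorems.DiagonalMirrorRPRDiagClusterDefs
import Summits.QuantumFields.YangMills.Theorems.DiagonalMirrorRPRTwoShiftExtraction

/-!
# Crux `WeakCouplingHypercubicLimitRP` (stmt-QuantumFields-27398), line `Sketch`, door B, R1-side:
# the PINNED two-shift probe (p-W1 of verdict #119) — model-external definitions (Defs)

Definitions file (`--supports stmt-QuantumFields-27398 --as helper`) of the crux lead `lead-27398-D1` g3 (docket director-ym g24,
O4 WORD 42 (2) (p1′) / WORD 44 (1)(e); critic idea-crit-9 g13 verdict #119 `two-shift-window-extraction` PASS-WITH-PRICE, price p-W1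
«PIN THE PROBE»).  The landed bridge `slowest_le_exp` / `oddTwistGap_of_twoShiftLetters` (✓ `…DiagonalMirrorRPRTwoShiftExtraction`) is
stated on probe data `𝔭 : TwoShiftProbes 𝔪` whose `budget`, `scale` are FREE reals tied to the model only through the `signal` field.  Here
the MODEL-EXTERNAL half of the probe is pinned to Wilson expectations on the scheme's own odd torus `2L_k+1`:

* `swapShiftPairing r sch Y n k` — the swap-paired, diagonally shifted expectation `∫ Y(Σ Ũ) · Y(τ_{−n e₀ + n e₁} Ũ) dμ_k` of
  `DiagCluster` (✓ `…DiagonalMirrorRPRDiagClusterDefs`) at `S := L_k` (the scheme's own torus), shift `n`;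
* `probeVariance r sch Y k` — `∫ Y(Ũ)² dμ_k − (∫ Y(Ũ) dμ_k)²`;
* `PinnedProbe sch` — a probe SEQUENCE `Y_k` in `DiagCluster`'s observable class: measurable, `|Y_k| ≤ B_k`, `diagBox T_k`-local, with a shift
  `n_k` admissible for BOTH shifts `n_k, 2n_k` (`2(2T_k + 2n_k + 3) ≤ L_k` eventually);
* `TwoShiftProbes.PinnedTo 𝔭 P C` — the probe data `𝔭` of the landed bridge READ their shift, budget and scale off the pinned probe:
  `𝔭.n = P.n`, `𝔭.budget k = |P_{n_k}(k) − P_{2n_k}(k)|` (the two actual shifted swap pairings), `𝔭.scale k = Var_k Y_k + C B_k²`.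

With these, K3 `BudgetDecay 𝔭 Δ` is a THEOREM from `DiagCluster r sch Δ C` (companion proof file
`…PencilRigidityWeakCouplingHypercubicLimitRPBudgetDecay`: `budgetDecay_of_diagCluster`), hence from `RPSpectral` by ✓`diagCluster_of_rpSpectral`.
NOT pinned here (the supplier's half, hands' P-chain): the sandwich-side fields `vis`, `W`, `r`, `j₀` and the `signal` inequality, which must
be DEFINED from the two-index weights of the SHIFTED sandwich on the eigen-package `slicePkgAt` (O4 WORD 44 (1)(e)); with `budget` external,
`signal` is a genuine constraint (no re-encoding by fiat).

HONEST FRAMING: vocabulary only; predicates and a data structure, no cited fact, no registered obligation; nothing about the weak-coupling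
behaviour of Wilson's model is asserted.  D1′, the crux ⟨27398⟩, its heart S6i and the summit are OPEN; the Yang–Mills mass gap is NOT proved
here or anywhere in the tree.  No instance, no notation, `autoImplicit false`.

References: Fröhlich–Israel–Lieb–Simon, CMP 62 (1978) Thm 2.1; Osterwalder–Seiler, Ann. Phys. 110 (1978) §2.
-/

set_option autoImplicit false

noncomputable section

open MeasureTheory Filter Topology
open Literature.MathematicalPhysics.QuantumLattice Literature.MathematicalPhysics.AQFT
  Literature.MathematicalPhysics.QuantumFieldTheory
open Summit.QuantumFields.YangMills.Cruxes.DiagonalMirrorRPR.SignTwistedDiagonalTrace (TwoShiftProbes DiagonalSliceModel)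

namespace Summit.QuantumFields.YangMills.Cruxes.DiagonalMirrorRPR.SpectralTransfer

variable {G : Type} [Group G] [TopologicalSpace G] [IsTopologicalGroup G] [CompactSpace G]
  [MeasurableSpace G] [BorelSpace G]

/-- **The swap-paired, diagonally shifted expectation on the scheme's own odd torus** `2L_k+1` at step `k`:
`∫ Y(Σ Ũ) · Y(τ_{−n e₀ + n e₁} Ũ) dμ_k` — the pairing of `DiagCluster` at `S := L_k`, shift `n`. -/
def swapShiftPairing (r : LatticeRep G) (sch : SpeciesScheme (YMSpecies G)) (Y : LGConfig 4 G → ℝ) (n k : ℕ) : ℝ :=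
  ∫ U, Y (torusLift (2 * sch.L k + 1) (configPerm (Equiv.swap (0 : Fin 4) 1) U)) *
      Y (configShift (-Pi.single 0 (n : ℤ) + Pi.single 1 (n : ℤ)) (torusLift (2 * sch.L k + 1) U))
    ∂(wilsonMeasure r.ρ (sch.β k) : Measure (GaugeConfig 4 (2 * sch.L k + 1) G))

/-- **The variance of a lifted functional** under Wilson's state of the scheme's own torus at step `k`:
`∫ Y(Ũ)² dμ_k − (∫ Y(Ũ) dμ_k)²`. -/
def probeVariance (r : LatticeRep G) (sch : SpeciesScheme (YMSpecies G)) (Y : LGConfig 4 G → ℝ) (k : ℕ) : ℝ :=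
  (∫ U, (Y (torusLift (2 * sch.L k + 1) U)) ^ 2
      ∂(wilsonMeasure r.ρ (sch.β k) : Measure (GaugeConfig 4 (2 * sch.L k + 1) G))) -
    (∫ U, Y (torusLift (2 * sch.L k + 1) U)
      ∂(wilsonMeasure r.ρ (sch.β k) : Measure (GaugeConfig 4 (2 * sch.L k + 1) G))) ^ 2

/-- **A pinned probe sequence** (p-W1): per step `k` a box-local functional `Y_k` in `DiagCluster`'s observable class — measurable,
`|Y_k| ≤ B_k`, depending on the links of `diagBox T_k` — and a diagonal shift `n_k` admissible for both shifts `n_k` and `2n_k` on the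
scheme's own torus (`2(2T_k + 2n_k + 3) ≤ L_k` eventually). -/
structure PinnedProbe (sch : SpeciesScheme (YMSpecies G)) where
  /-- the probe functionals -/
  Y : ℕ → LGConfig 4 G → ℝ
  /-- box size, sup bound, diagonal shift -/
  T : ℕ → ℕ
  B : ℕ → ℝ
  n : ℕ → ℕ
  measurable : ∀ k, Measurable (Y k)
  bdd : ∀ k U, |Y k U| ≤ B k
  boxLocal : ∀ k, DependsOn (Y k) (diagBox (T k))
  room : ∀ᶠ k in atTop, 2 * (2 * T k + 2 * n k + 3) ≤ sch.L k

/-- **`𝔭` is pinned to the probe `P` with thermal constant `C`**: the two-shift probe data of the landed bridge (✓ `TwoShiftProbes`) read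
their shift, budget and scale off the pinned probe — `𝔭.n = P.n`, `𝔭.budget k = |P_{n_k}(k) − P_{2n_k}(k)|` (actual shifted swap pairings,
model-external) and `𝔭.scale k = Var_k Y_k + C·B_k²`. -/
def _root_.Summit.QuantumFields.YangMills.Cruxes.DiagonalMirrorRPR.SignTwistedDiagonalTrace.TwoShiftProbes.PinnedTo
    {r : LatticeRep G} {sch : SpeciesScheme (YMSpecies G)} {𝔪 : DiagonalSliceModel r sch} (𝔭 : TwoShiftProbes 𝔪)
    (P : PinnedProbe sch) (C : ℝ) : Prop :=
  (∀ k, 𝔭.n k = P.n k) ∧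
  (∀ k, 𝔭.budget k = |swapShiftPairing r sch (P.Y k) (P.n k) k - swapShiftPairing r sch (P.Y k) (2 * P.n k) k|) ∧
  (∀ k, 𝔭.scale k = probeVariance r sch (P.Y k) k + C * P.B k ^ 2)

end Summit.QuantumFields.YangMills.Cruxes.DiagonalMirrorRPR.SpectralTransfer

end
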